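import Summits.ValiantsHypothesis.ValiantsHypothesis.Theses.LacunarySymmetroid
import Summits.ValiantsHypothesis.ValiantsHypothesis.Theorems.LacunarySymmetroidMatrixDescartesCensusKLawBridge
import Summits.ValiantsHypothesis.ValiantsHypothesis.Theorems.LacunarySymmetroidMatrixDescartesCensusFrame
import Summits.ValiantsHypothesis.ValiantsHypothesis.Theorems.LacunarySymmetroidMatrixDescartesCensusSignSplitInconsistent
import Summits.ValiantsHypothesis.ValiantsHypothesis.Theorems.LacunarySymmetroidMatrixDescartesCensusPencilPlaneLaw
import Summits.ValiantsHypothesis.ValiantsHypothesis.Theorems.LacunarySymmetroidMatrixDescartesCensusPencilPlaneSharp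

/-!
# Crux `MatrixDescartes` (stmt-ValiantsHypothesis-18050) — line `span-rank` (pencil-plane law)
# (tropical / Newton-polytope lens; ideator val-idea-1, D-0148 (a), LINE 2, 2026-08-28)

HONEST FRAMING.  A skeleton over OPEN statements plus proved glue.  `stub_spanOne`, `stub_pencilPlane` CLOSED by p589587, `stub_pencilPlane_sharp` by p590094 (2026-08-28); only `stub_spanLaw` (the law) is `sorry`.  Nothing here asserts
`MatrixDescartes`, Conjecture B (`KPlusLogSqLaw`), a door, or anything about `VP ≠ VNP`; a law candidate does not
move `VP ≠ VNP`.  `SpanLaw` is a law SHAPE stronger than B (it implies B, proved below); the line's kernel content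
is the SECTOR `r ≤ 2` (all formats) and the new census axis `r`.

## Idea (one lever): the SPAN RANK of the letter set
Write the `K` letters in a basis of their span, `S_l = Σ_{i<r} c_{l i} B_i` (`r` = span rank,
`r ≤ min (K, m(m+1)/2)`).  Then the pencil is `F(x) = Σ_{i<r} p_i(x) B_i` with `r` K-nomials
`p_i(x) = Σ_l c_{l i} x^{d_l}` on the COMMON support `d`, and

  `det F(x) = P_B(p_1(x), …, p_r(x))`,   `P_B(y) := det Σ_i y_i B_i`  (the symmetroid form of the net, degree `m`).

So `Z₊` = number of positive parameters at which the K-NOMIAL CURVE `γ = [p_1 : ⋯ : p_r] ⊂ ℝP^{r-1}` meets the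
degree-`m` hypersurface `{P_B = 0}`.  The root count is graded by `r`, not only by `(m, K)`:
* `r = 1`: `det F = p_1^m det B_1` ⇒ `Z₊ ≤ K − 1` (`stub_spanOne`).
* `r = 2` (**pencil-plane law**, `stub_pencilPlane`, the line's FIRST RUNG, provable): with `φ(λ) = det (λ B_1 + B_2)`
  (degree `≤ m`), every positive zero `x` with `p_2(x) ≠ 0` satisfies `φ(p_1(x)/p_2(x)) = 0`, i.e. `x` is a positive
  zero of one of the `≤ m` K-nomials `p_1 − λ_j p_2` (`λ_j` the real roots of `φ`; if `φ ≡ 0` then `det F ≡ 0` and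
  nothing is counted); zeros with `p_2(x) = 0` force `p_1(x)^m det B_1 = 0`: if `det B_1 ≠ 0` they are common zeros of
  `p_1, p_2` (already among the previous ones when `φ` has a real root, else `≤ K − 1 ≤ m(K−1)`), and if `det B_1 = 0`
  then `deg φ ≤ m − 1` and the `≤ K − 1` zeros of `p_2` are added: in all cases `Z₊ ≤ m (K − 1)`.  NO symmetry and no
  sign condition is used; the bound is SHARP on symmetric pencils for every `(m, K)` (`stub_pencilPlane_sharp`:
  `B_1 = I`, `B_2 = diag(λ)`, `p_2 = −r(x)` alternating with `K − 1` simple positive roots, `p_1 = r(βx)`-type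
  perturbations) and it is the SKELETON VALUE `m(K−1)` of the split class (line `lorentzian-shadow`, landed rung
  `shadowPathBound`) and of the diagonal designs — reached here by an ARCHIMEDEAN argument.
* `r = 3` is the first rank with excess: for `m = 2`, `Sym₂(ℝ)` is 3-dimensional, so the whole `(2, K)` column of the
  census (`9, 14, ≥ 18, ≥ 21, ≥ 25`) is the `r = 3` census: a K-nomial plane curve against a CONIC.  For general `m`
  and a net containing a definite matrix, `{P_B = 0} ⊂ ℝP²` is a Helton–Vinnikov curve (`⌊m/2⌋` nested ovals
  [+ a pseudoline]) and `Z₊` counts crossings of the K-nomial plane curve with the ovals (located model; instrument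
  `ζ(m,K,3)` = census with letters confined to a 3-dimensional net, kit-countable at `(3,4)`, `(4,4)`).
* LAW SHAPE on the new axis (`SpanLaw`, conjecture, typed, never asserted): `log₂ Z₊ ≤ C (r + log₂² m) + C log₂ (K+1)`
  — the exponential cost sits in the span rank, the letter count enters polynomially.  Since `r ≤ K` always,
  `SpanLaw → KPlusLogSqLaw → MatrixDescartes` (proved below); at extremal formats `r = K` and the shape IS B's, so the
  law is off B's wall only where `r < K` (dependent letters).

Stubs (sorries ONLY here): `stub_spanOne` (S), `stub_pencilPlane` (M, FIRST RUNG, proof above), `stub_pencilPlane_sharp`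
(M, construction above), `stub_spanLaw` (THE LAW SHAPE, crux-level bet).  Glue proved: `posRootLawAt_of_spanRootLawAt`
(`r = K` specialisation), `kPlusLogSqLaw_of_spanLaw`, `MatrixDescartes_of`.
-/

set_option linter.dupNamespace false
set_option linter.unusedVariables false

namespace Summit.ValiantsHypothesis.ValiantsHypothesis.Cruxes.MatrixDescartes.SpanRank

open Polynomial Matrix Finset
open scoped BigOperators
open Summit.ValiantsHypothesis.ValiantsHypothesis.Theorems.MatrixDescartes.Negative (PosRootLawAt)
open Summit.ValiantsHypothesis.ValiantsHypothesis.Theorems.LacunarySymmetroidMatrixDescartes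
open Summit.ValiantsHypothesis.ValiantsHypothesis.Theorems.LacunarySymmetroidMatrixDescartes.Census.SignSplit
  (pencil posRootCount)

/-! ## The span-rank rows -/

/-- **Span-rank row** `ζ(m, K, r) ≤ bound`: every lacunary pencil of size `m` with `K` terms whose letters are real
combinations `S_l = Σ_i c l i • B i` of `r` fixed matrices `B : Fin r → M_m(ℝ)` (no symmetry required) has at most
`bound` distinct positive real roots of its determinant (`posRootCount`, token-identical with the census currency). -/
def SpanRootLawAt (m K r bound : ℕ) : Prop :=
  ∀ (d : Fin K → ℕ) (B : Fin r → Matrix (Fin m) (Fin m) ℝ) (c : Fin K → Fin r → ℝ),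
    posRootCount d (fun l => ∑ i, c l i • B i) ≤ bound

/-- `r = 1`: `det (p(x) • B) = p(x)^m det B`, so `Z₊ ≤ K − 1` (Descartes for one K-nomial). [S] -/
theorem stub_spanOne : ∀ m K : ℕ, SpanRootLawAt m K 1 (K - 1) :=
  -- CLOSED 2026-08-28 (p589587): `Theorems/…CensusPencilPlaneLaw.lean`, `Census.SpanRank.spanRootLawAt_one`.
  fun m K => Theorems.LacunarySymmetroidMatrixDescartes.Census.SpanRank.spanRootLawAt_one m K

/-- **Pencil-plane law (FIRST RUNG, r = 2).**  Letters in the span of two matrices `A, B`: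
`F(x) = p(x) A + q(x) B` with `p, q` K-nomials on a common support ⇒ `Z₊ ≤ m (K − 1)` — via the real roots
`λ_j` of `φ(λ) = det(λ A + B)` (degree `≤ m`): positive zeros are zeros of the K-nomials `p − λ_j q` (and of `q` when
`det A = 0`, in which case `deg φ ≤ m − 1`).  No symmetry, no semidefiniteness. [M] -/
theorem stub_pencilPlane : ∀ m K : ℕ, SpanRootLawAt m K 2 (m * (K - 1)) :=
  -- CLOSED 2026-08-28 (p589587): `Theorems/…CensusPencilPlaneLaw.lean`, `Census.SpanRank.spanRootLawAt_two`
  -- (generalized eigenvalues of the net; all formats, no symmetry hypothesis).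
  fun m K => Theorems.LacunarySymmetroidMatrixDescartes.Census.SpanRank.spanRootLawAt_two m K

/-- Sharpness of the pencil-plane law on SYMMETRIC pencils at every format `m ≥ 1`, `K ≥ 2`:
`A = I`, `B = diag(μ_1, …, μ_m)` with distinct small `μ_j < 0`, `q = −r`, `p = r̃` where `r` is a K-nomial with
`K − 1` simple positive roots and alternating signs; the `m` K-nomials `p − λ_j q` keep the alternation and have
pairwise distinct simple roots ⇒ exactly `m (K − 1)` positive roots. [M] -/
theorem stub_pencilPlane_sharp :
    ∀ m K : ℕ, 1 ≤ m → 2 ≤ K → ¬ SpanRootLawAt m K 2 (m * (K - 1) - 1) :=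
  -- CLOSED 2026-08-28 (p590094): `Theorems/…CensusPencilPlaneSharp.lean`, witness net ⟨1, diag(1..m)⟩ on support
  -- (0,…,K−1) with p = ∏(X − 2(i+1)), q = ∏(X − (2(i+1)+1)); row exact: `spanRootLawAt_two_iff`.
  fun m K hm hK => Theorems.LacunarySymmetroidMatrixDescartes.Census.SpanRank.not_spanRootLawAt_two_pred m K hm hK

/-- **SpanLaw** (law SHAPE on the span-rank axis; a CONJECTURE of this line, typed, never asserted):
`Z₊(m, K, r) ≤ 2^{C (r + log₂² m)} · (K + 1)^C` — exponential in the span rank `r`, quasi-polynomial in the size,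
polynomial in the number of letters.  `r ≤ K` makes it imply B (`kPlusLogSqLaw_of_spanLaw`). -/
def SpanLaw : Prop :=
  ∃ C : ℕ, ∀ m K r : ℕ, SpanRootLawAt m K r (2 ^ (C * (r + Nat.log 2 m ^ 2)) * (K + 1) ^ C)

/-- THE LAW stub of the line (crux-level bet). [XL] -/
theorem stub_spanLaw : SpanLaw := by
  sorry

/-! ## Glue (proved) -/

/-- `r = K` specialisation: every letter family lies in its own span, so a span-rank row at `r = K` is a census
row `PosRootLawAt` with the same bound (the symmetry hypothesis of the census row is simply dropped). -/
theorem posRootLawAt_of_spanRootLawAt {m K bound : ℕ} (h : SpanRootLawAt m K K bound) :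
    PosRootLawAt m K bound := by
  intro d S hS
  have hSelf : (fun l => ∑ i, (fun l' i' => if l' = i' then (1 : ℝ) else 0) l i • S i) = S := by
    funext l
    simp [ite_smul, Finset.sum_ite_eq]
  have h1 := h d S (fun l i => if l = i then (1 : ℝ) else 0)
  rw [hSelf] at h1
  simpa [posRootCount, pencil] using h1

/-- row `K = 0`: an empty pencil has determinant `1` (`m = 0`) or `0` (`m ≥ 1`); no counted roots. -/
theorem realRootLawAt_noTerms (m B : ℕ) : RealRootLawAt m 0 B := by
  intro d S hS
  have h0 : (∑ l : Fin 0, ((Polynomial.X : Polynomial ℝ) ^ d l) • (S l).map Polynomial.C) = 0 := by simp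
  rw [h0]
  rcases Nat.eq_zero_or_pos m with hm | hm
  · subst hm
    simp
  · haveI : Nonempty (Fin m) := ⟨⟨0, hm⟩⟩
    rw [Matrix.det_zero]
    simp

/-- arithmetic: `(K+1)^C ≤ 2^(C K)`. -/
theorem succ_pow_le_two_pow_mul (K C : ℕ) : (K + 1) ^ C ≤ 2 ^ (C * K) := by
  have h : K + 1 ≤ 2 ^ K := Nat.lt_two_pow_self
  calc (K + 1) ^ C ≤ (2 ^ K) ^ C := Nat.pow_le_pow_left h C
    _ = 2 ^ (C * K) := by rw [← pow_mul, Nat.mul_comm]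

/-- **SpanLaw ⇒ Conjecture B** (constant `3C + 2`). -/
theorem kPlusLogSqLaw_of_spanLaw (h : SpanLaw) : KPlusLogSqLaw := by
  obtain ⟨C, hC⟩ := h
  refine ⟨3 * C + 2, fun m K => ?_⟩
  rcases Nat.eq_zero_or_pos K with hK | hK
  · subst hK
    exact realRootLawAt_noTerms m _
  set L : ℕ := Nat.log 2 m ^ 2 with hL
  have hpos : PosRootLawAt m K (2 ^ (C * (K + L)) * (K + 1) ^ C) :=
    posRootLawAt_of_spanRootLawAt (hC m K K)
  have hreal := Census.realRootLawAt_of_posRootLawAt hpos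
  refine Census.realRootLawAt_mono ?_ hreal
  have h1 : 2 ^ (C * (K + L)) * (K + 1) ^ C ≤ 2 ^ (2 * C * (K + L)) := by
    calc 2 ^ (C * (K + L)) * (K + 1) ^ C ≤ 2 ^ (C * (K + L)) * 2 ^ (C * K) :=
          Nat.mul_le_mul_left _ (succ_pow_le_two_pow_mul K C)
      _ = 2 ^ (C * (K + L) + C * K) := by rw [← pow_add]
      _ ≤ 2 ^ (2 * C * (K + L)) := Nat.pow_le_pow_right (by norm_num) (by nlinarith [Nat.zero_le (C * L)])
  have h2 : 2 * 2 ^ (2 * C * (K + L)) + 1 ≤ 2 ^ (2 * C * (K + L) + 2) := by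
    have : 1 ≤ 2 ^ (2 * C * (K + L)) := Nat.one_le_two_pow
    rw [pow_add]; norm_num; omega
  have h3 : 2 * C * (K + L) + 2 ≤ (3 * C + 2) * (K + L) := by nlinarith
  calc 2 * (2 ^ (C * (K + L)) * (K + 1) ^ C) + 1 ≤ 2 * 2 ^ (2 * C * (K + L)) + 1 := by omega
    _ ≤ 2 ^ (2 * C * (K + L) + 2) := h2
    _ ≤ 2 ^ ((3 * C + 2) * (K + L)) := Nat.pow_le_pow_right (by norm_num) h3

/-- B from the law stub, by name. -/
theorem kPlusLogSqLaw_of : KPlusLogSqLaw := kPlusLogSqLaw_of_spanLaw stub_spanLaw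

/-- **The line's composition: the crux `MatrixDescartes`, by name** (tree bridge `Census.matrixDescartes_of_kPlusLogSqLaw`). -/
theorem MatrixDescartes_of :
    Summit.ValiantsHypothesis.ValiantsHypothesis.Theses.LacunarySymmetroid.MatrixDescartes :=
  Census.matrixDescartes_of_kPlusLogSqLaw kPlusLogSqLaw_of

/-! ## Honesty lemma (proved): at `r = K` the law shape is B's — the pencil-plane sector is where it differs -/

/-- B ⇒ the `r = K` rows of `SpanLaw`'s shape restricted to symmetric letters hold with B's budget: on extremal
formats (independent letters) `SpanLaw` says nothing beyond B. -/
theorem spanRow_of_kPlusLogSqLaw (hB : KPlusLogSqLaw) :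
    ∃ C : ℕ, ∀ m K : ℕ, PosRootLawAt m K (2 ^ (C * (K + Nat.log 2 m ^ 2))) := by
  obtain ⟨C, hC⟩ := hB
  exact ⟨C, fun m K => Census.posRootLawAt_of_realRootLawAt (hC m K)⟩

end Summit.ValiantsHypothesis.ValiantsHypothesis.Cruxes.MatrixDescartes.SpanRank
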